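import Literature.MathematicalPhysics.PowerSystems.KuramotoRingStabilityDichotomy
import Literature.Analysis.Matrix.KyFanMaximumPrinciple
import HarnessLib

/-!
# Taylor's Lemma 2.1 and Delabays–Coletta–Jacquod's «at most one angle difference exceeds π/2»
# IN THE PRINT'S OWN MODEL — the first-order Kuramoto network — for BOTH notions of stability: the
# print's (the stability matrix `M = −L(θ)` is negative semidefinite / «all the eigenvalues of M are
# less than or equal to zero») and Lyapunov stability of the phase-locked solution

Topic `Literature/MathematicalPhysics/PowerSystems`, namespace
`Literature.MathematicalPhysics.PowerSystems.NonuniformKuramoto`. The tree has Taylor's cut-set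
lemma and DCJ's at-most-one-long-line corollary for the damped SECOND-ORDER (swing) model
(`ClassicalModel.LosslessSystem.cut_nonneg_of_hessForm_nonneg`, `….cut_nonneg_of_stable`,
`ClassicalModel.loadedRing_card_negative_lines_le_one_of_stable`). Both prints are about the
FIRST-ORDER Kuramoto model — Taylor (1.1) `θ̇ᵢ = ωᵢ + k Σⱼ Aᵢⱼ sin(θⱼ − θᵢ)`, DCJ (2.1)
`θ̇ᵢ = Pᵢ − K Σ_{j∼i} sin(θᵢ − θⱼ)` — with «stable» DEFINED through the stability matrix: Taylor
(2.2)–(2.3) «The first-order differential system (2.2) is stable if and only if all the eigenvalues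
of the matrix M are less than or equal to zero»; DCJ (2.4) `Mᵢⱼ = K cos(θᵢ − θⱼ)` (`i ≠ j`),
`Mᵢᵢ = −Σ_{k∼i} K cos(θᵢ − θₖ)`, «the synchronous state is stable if M is negative semidefinite and
unstable otherwise». This file states and proves both results in that model and with that notion,
for the tree's `NonuniformKuramoto n` (`Dᵢθ̇ᵢ = ωᵢ − Σⱼ Pᵢⱼ sin(θᵢ − θⱼ + φᵢⱼ)`, here `φ = 0`,
`P` symmetric, any `Dᵢ > 0` — the prints are `Dᵢ = 1`, `Pᵢⱼ = kAᵢⱼ` / `K·[i ∼ j]`), AND with the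
dynamic notion (Lyapunov stability of the phase-locked solution `t ↦ θ* + ω_sync t𝟙`, motions exist
from every phase vector: `exists_globalSolution`), the latter through gridfusion-lit-2's
hypothesis-free unstable clause `lockedSolution_unstable_of_negativeDirection` (Lyapunov's indirect
method, Khalil Thm 4.7 part 2). No definition, no named fact, no axiom: the print's stability matrix
is `−(Kur.toDroopNetwork.lap θ)` (lit-2's linearised Laplacian, `DroopSyncExponentialStability`),
which IS the Jacobian of the model (`hasFDerivAt_field`, §1).

SOURCES (read on the page this session). R. Taylor, J. Phys. A 45 (2012) 055102 [TaylorKuramoto2012]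
(`lit read arxiv:1109.4451` p0007 L15 (definition of stable), p0008 L1–L5 (Lemma 2.1 and proof:
«Since the system … is stable, it follows that the matrix M is negative semi-definite … Choose z to
be the vector defined by zᵢ = 1 for i ∈ S, while zᵢ = 0 for i ∉ S … This proves the lemma»)).
R. Delabays, T. Coletta, P. Jacquod, J. Math. Phys. 57 (2016) 032701 [DelabaysColettaJacquod2016]
(`lit read arxiv:1512.04266` p0005 L55–L125 (model (2.1), power flow (2.2), linearisation (2.3),
stability matrix (2.4)), p0006 L1–L10 («The eigenvalues of M are called Lyapunov exponents … the
synchronous state is stable if M is negative semidefinite and unstable otherwise»), p0013 L21–L38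
(**Lemma 4.10 (Taylor)**: «Let {θᵢ⁽⁰⁾} be any stable solution of the power flow Eq. (2.2) on any
network. Then for any non-empty node subset S, Σ_{⟨ij⟩: i∈S, j∉S} cos(Δᵢⱼ⁽⁰⁾) ≥ 0», and «In our case
of a cycle network, if the angle differences on two lines are larger than π/2 or less than −π/2,
removing these two lines splits the network in two parts, S and Sᶜ, such that Σ cos(Δᵢⱼ⁽⁰⁾) < 0, and
the solution is unstable. We conclude that there is at most a single |Δ_{i,i+1}| > π/2»)).
H. K. Khalil, *Nonlinear Systems* [Khalil2002] Thm 4.7 (part 2), through lit-2's typed clause.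
A.-L. Do, S. Boccaletti, T. Gross, Phys. Rev. Lett. 108 (2012) 194102 [DoBoccalettiGross2012]
(`lit read arxiv:1012.0722` p0002 L49 (stability through the Jacobian `J_{ik} = ∂ẋᵢ/∂xₖ`), p0003
L63–L66 («To admit stable solutions, a dynamical system with symmetric Jacobian and ZRS must possess a
spanning tree made up entirely of positive elements. To prove the statement above consider that in a
network without a positive spanning tree it must be possible to partition the nodes into two nonempty
sets I₁, I₂ such that J_{ij} ≤ 0 ∀ i ∈ I₁, j ∈ I₂»), p0004 L20 («the existence of a spanning tree of
positive elements is a necessary condition for stability»), L34–L35 («Applied to the Kuramoto model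
… in any phase locked state a spanning tree must exist on which the phase difference between any two
coupled oscillators obeys |x_j − x_i| < π/2»)); DCJ's restatement p0013 L40–L47 («if {θᵢ⁽⁰⁾} is a
stable solution … then there exists a spanning tree T of the network such that for all edges e ∈ E_T,
cos(Δ_e⁽⁰⁾) ≥ 0 … Taylor's lemma seems to be slightly more general»).

## What is proved (`Kur : NonuniformKuramoto n`; `w_ij(θ) = Pᵢⱼ cos(θᵢ − θⱼ)` = `linWeight`)

* §1 THE PRINT'S STABILITY MATRIX: `linForm_indicator` (Taylor's test vector:
  `Σᵢ zᵢ Σⱼ wᵢⱼ(zᵢ − zⱼ) = Σ_{i∈S}Σ_{j∉S} Pᵢⱼcos(θᵢ − θⱼ)` for `z = 1_S`), `dotProduct_lap_mulVec`,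
  `hasFDerivAt_field` (for `φ = 0`, `Dᵢ ≠ 0` the Jacobian of the model at `θ` is `−D⁻¹L(θ)`),
  `jacobian_eq_neg_lap` (`Dᵢ = 1`: the Jacobian is `M = −L(θ)`, DCJ (2.4)), `isHermitian_neg_lap`,
  ★ **`negSemidef_iff_eigenvalues_nonpos`** (Taylor's words = DCJ's words: for the symmetric `M`,
  «M negative semidefinite» ⇔ «all eigenvalues of M ≤ 0»).
* §2 THE PRINT'S NOTION: ★★ **`cut_nonneg_of_stabilityMatrix_negSemidef`** (TAYLOR'S LEMMA 2.1 /
  DCJ LEMMA 4.10 VERBATIM: `M(θ) = −L(θ)` negative semidefinite ⇒ for every node set `S`,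
  `Σ_{i∈S, j∉S} Pᵢⱼ cos(θᵢ − θⱼ) ≥ 0`; no symmetry, sign or equilibrium hypothesis is needed for
  this implication), `cut_nonneg_of_eigenvalues_nonpos` (the eigenvalue wording, `P` symmetric),
  `stabilityMatrix_not_negSemidef_of_negative_cut` (contrapositive: «then the solution is unstable»
  in the print's sense).
* §3 THE DYNAMIC NOTION (`Dᵢ > 0`, `φ = 0`, `P` symmetric, `θ*` phase-locked:
  `fieldᵢ(θ*) = ω_sync = Σωⱼ/ΣDⱼ`): `lockedSolution_unstable_of_negative_cut` (a negative cut makes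
  the locked solution Lyapunov-UNSTABLE — lit-2's clause on the indicator), ★★
  **`linForm_nonneg_of_lockedSolution_stable`** (a Lyapunov-STABLE locked solution has
  `Σᵢ vᵢ Σⱼ wᵢⱼ(vᵢ − vⱼ) ≥ 0` for every `v`, i.e. `M` negative semidefinite: the print's notion is
  NECESSARY for the dynamic one), ★★ **`cut_nonneg_of_lockedSolution_stable`** (Taylor's Lemma 2.1
  with «stable» = Lyapunov stable).
* §4 THE CYCLE (DCJ §4.3; ring with line constants `Kₖ > 0` between `k` and `ρk = k + 1 (mod N)`,
  `N = n + 1 ≥ 3`, any natural frequencies): `ring_linForm_indicator_arc` (the arc between two lines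
  is cut exactly by them), ★★ **`ring_at_most_one_negative_line_of_stabilityMatrix_negSemidef`** /
  **`ring_card_negative_lines_le_one_of_stabilityMatrix_negSemidef`** (print's notion: a stable
  solution has at most one line with `cos(θₖ − θ_{ρk}) < 0`, i.e. `|Δ| > π/2 (mod 2π)`), ★★
  **`ring_at_most_one_negative_line_of_lockedSolution_stable`** /
  **`ring_card_negative_lines_le_one_of_lockedSolution_stable`** (dynamic notion).
* §5 (append) DO–BOCCALETTI–GROSS'S SPANNING-TREE CRITERION in cut form («contains a spanning tree»
  ⇔ every cut of the node set is crossed by a line of the subnetwork; the tree ⇒ cut direction is the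
  tree's `ClassicalModel.couplingConnected_of_rootedTree`): `cut_neg_of_forall_cos_neg`, ★★
  **`couplingConnected_nonnegCos_of_stabilityMatrix_negSemidef`** (DCJ's form: `Pᵢⱼ ≥ 0`, connected
  coupling graph, `M` NSD ⇒ the lines with `cos(θᵢ − θⱼ) ≥ 0` connect all nodes), ★★
  **`couplingConnected_posCos_of_stabilityMatrix_negDef`** (DBG's form: `M` negative definite off the
  rotation ⇒ the lines with `|Δ| < π/2`, i.e. `cos > 0`, connect all nodes — no connectivity
  hypothesis), ★★ **`couplingConnected_nonnegCos_of_lockedSolution_stable`** (Lyapunov notion).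

THREE COLUMNS. CERTIFIED for MODEL `M_K` = first-order Kuramoto network `Dᵢθ̇ᵢ = ωᵢ − ΣⱼPᵢⱼsin(θᵢ −
θⱼ)`, `P` symmetric, any `Dᵢ > 0` (Taylor's and DCJ's models: `Dᵢ = 1`, uniform line constant):
necessary conditions for stability in the print's sense AND in the Lyapunov sense. NOT CLAIMED:
sufficiency («this condition is a necessary condition only», Taylor p0007); anything about a grid.
-/

noncomputable section

open Real Set Filter Topology Metric Finset
open scoped Matrix

namespace Literature.MathematicalPhysics.PowerSystems

namespace NonuniformKuramoto

variable {n : ℕ} (Kur : NonuniformKuramoto n)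

/-! ### §1. The print's stability matrix `M(θ) = −L(θ)`, Taylor's test vector, and the Jacobian -/

/-- **Taylor's test vector**: for the indicator `z = 1_S` of a node set,
`Σᵢ zᵢ Σⱼ wᵢⱼ(θ)(zᵢ − zⱼ) = Σ_{i∈S} Σ_{j∉S} Pᵢⱼ cos(θᵢ − θⱼ)` («zᵀMz is the sum of elements of M
where both the row and column indices are elements of S»; no symmetry needed).
[cite: TaylorKuramoto2012, §2 proof of Lemma 2.1 (arXiv:1109.4451 p0008 L3–L5)] -/
theorem linForm_indicator (θ : Fin n → ℝ) (S : Finset (Fin n)) :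
    ∑ i, (if i ∈ S then (1 : ℝ) else 0) * ∑ j, Kur.toDroopNetwork.linWeight θ i j
        * ((if i ∈ S then (1 : ℝ) else 0) - (if j ∈ S then (1 : ℝ) else 0))
      = ∑ i ∈ S, ∑ j ∈ Sᶜ, Kur.P i j * Real.cos (θ i - θ j) := by
  have h1 : ∀ i, (if i ∈ S then (1 : ℝ) else 0) * ∑ j, Kur.toDroopNetwork.linWeight θ i j
        * ((if i ∈ S then (1 : ℝ) else 0) - (if j ∈ S then (1 : ℝ) else 0))
      = if i ∈ S then ∑ j ∈ Sᶜ, Kur.P i j * Real.cos (θ i - θ j) else 0 := by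
    intro i
    by_cases hi : i ∈ S
    · rw [if_pos hi, if_pos hi, one_mul]
      have h2 : ∀ j, Kur.toDroopNetwork.linWeight θ i j * (1 - (if j ∈ S then (1 : ℝ) else 0))
          = if j ∈ Sᶜ then Kur.P i j * Real.cos (θ i - θ j) else 0 := by
        intro j
        rw [Kur.toDroopNetwork_linWeight]
        by_cases hj : j ∈ S
        · rw [if_pos hj, if_neg (fun h => (Finset.mem_compl.1 h) hj)]; ring
        · rw [if_neg hj, if_pos (Finset.mem_compl.2 hj)]; ring
      rw [Finset.sum_congr rfl fun j _ => h2 j, Finset.sum_ite_mem, Finset.univ_inter]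
    · rw [if_neg hi, if_neg hi, zero_mul]
  rw [Finset.sum_congr rfl fun i _ => h1 i, Finset.sum_ite_mem, Finset.univ_inter]

/-- The quadratic form of lit-2's linearised Laplacian: `vᵀL(θ)v = Σᵢ vᵢ Σⱼ wᵢⱼ(θ)(vᵢ − vⱼ)`, so
that `zᵀMz = −Σᵢ zᵢ Σⱼ wᵢⱼ(zᵢ − zⱼ)` for the print's `M = −L`.
[cite: DelabaysColettaJacquod2016, §2.2 eqs. (2.3)–(2.4) (arXiv:1512.04266 p0005 L99–L124)] -/
theorem dotProduct_lap_mulVec (θ v : Fin n → ℝ) :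
    v ⬝ᵥ (Kur.toDroopNetwork.lap θ *ᵥ v)
      = ∑ i, v i * ∑ j, Kur.toDroopNetwork.linWeight θ i j * (v i - v j) := by
  simp only [dotProduct, DroopNetwork.lap_mulVec]

/-- **The stability matrix is the Jacobian**: for zero phase shifts and nonzero time constants the
Kuramoto field `θ ↦ ((ωᵢ − ΣⱼPᵢⱼsin(θᵢ − θⱼ))/Dᵢ)ᵢ` has Fréchet derivative `−D⁻¹L(θ)` at every `θ`
(the field is lit-2's (Aux) field plus the constant `ω_sync`, `field_eq_auxField_add`).
«δθ̇ᵢ = −Σ_{j∼i} K cos(θᵢ⁽⁰⁾ − θⱼ⁽⁰⁾)(δθᵢ − δθⱼ)».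
[cite: DelabaysColettaJacquod2016, §2.2 eq. (2.3) (arXiv:1512.04266 p0005 L99–L107); TaylorKuramoto2012, §2 eqs. (2.2)–(2.3)] -/
theorem hasFDerivAt_field (hφ : ∀ i j, Kur.φ i j = 0) (hD : ∀ i, Kur.D i ≠ 0) (θ : Fin n → ℝ) :
    HasFDerivAt Kur.field
      (LinearMap.toContinuousLinearMap (Matrix.toLin' (Kur.toDroopNetwork.auxJac θ))) θ := by
  have hfun : Kur.field = fun x => Kur.toDroopNetwork.auxField x
      + fun _ : Fin n => (∑ j, Kur.ω j) / ∑ j, Kur.D j := by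
    funext x i
    rw [Pi.add_apply, Kur.field_eq_auxField_add hφ hD x i]
  rw [hfun]
  exact (DroopNetwork.hasFDerivAt_auxField (N := Kur.toDroopNetwork) θ).add_const _

/-- **For unit time constants the Jacobian IS the print's `M = −L(θ)`**: `Mᵢⱼ = Pᵢⱼcos(θᵢ − θⱼ)`
(`i ≠ j`), `Mᵢᵢ = −Σ_{k≠i} Pᵢₖcos(θᵢ − θₖ)` (with `Pᵢᵢ = 0` as in print).
[cite: DelabaysColettaJacquod2016, §2.2 eq. (2.4) (arXiv:1512.04266 p0005 L110–L124); TaylorKuramoto2012, §2 eq. (2.3)] -/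
theorem jacobian_eq_neg_lap (hD1 : ∀ i, Kur.D i = 1) (θ : Fin n → ℝ) :
    Kur.toDroopNetwork.auxJac θ = -Kur.toDroopNetwork.lap θ := by
  funext i j
  have hDc : Kur.toDroopNetwork.Dc i = 1 := hD1 i
  simp only [DroopNetwork.auxJac, hDc, div_one, Matrix.neg_apply]

/-- For symmetric `P` the stability matrix `M = −L(θ)` is real symmetric («as M is real symmetric,
all its eigenvalues are real»). [cite: DelabaysColettaJacquod2016, §2.2 (arXiv:1512.04266 p0006 L7)] -/
theorem isHermitian_neg_lap (hP : ∀ i j, Kur.P i j = Kur.P j i) (θ : Fin n → ℝ) :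
    (-Kur.toDroopNetwork.lap θ).IsHermitian := by
  have hY : ∀ i j, Kur.toDroopNetwork.Yabs i j = Kur.toDroopNetwork.Yabs j i := fun i j => hP i j
  have hL : (Kur.toDroopNetwork.lap θ).IsHermitian := by
    have hs := DroopNetwork.lap_symm (N := Kur.toDroopNetwork) hY θ
    rw [Matrix.IsHermitian, Matrix.conjTranspose_eq_transpose_of_trivial]
    exact Matrix.ext fun i j => by rw [Matrix.transpose_apply]; exact hs j i
  exact hL.neg

/-- ★ **Taylor's wording = DCJ's wording** for a real symmetric matrix `M`: «all the eigenvalues of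
M are less than or equal to zero» ⇔ «M is negative semidefinite» (`zᵀMz ≤ 0` for every `z`).
[cite: TaylorKuramoto2012, §2 (arXiv:1109.4451 p0007 L15, p0008 L3 «it follows that the matrix M is negative semi-definite»); DelabaysColettaJacquod2016, §2.2 (arXiv:1512.04266 p0006 L2–L10)] -/
theorem negSemidef_iff_eigenvalues_nonpos {M : Matrix (Fin n) (Fin n) ℝ} (hM : M.IsHermitian) :
    (∀ z : Fin n → ℝ, z ⬝ᵥ (M *ᵥ z) ≤ 0) ↔ ∀ i, hM.eigenvalues i ≤ 0 := by
  constructor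
  · intro h i
    have he := hM.eigenvalues_eq i
    rw [he]
    have h1 := h ((hM.eigenvectorBasis i).ofLp)
    simpa using h1
  · intro h z
    rw [Literature.Analysis.Matrix.KyFan.dotProduct_mulVec_eq_sum_eigen hM z]
    exact Finset.sum_nonpos fun i _ => mul_nonpos_of_nonpos_of_nonneg (h i) (sq_nonneg _)

/-! ### §2. The print's notion: a negative semidefinite stability matrix forces every cut `≥ 0` -/

/-- ★★ **TAYLOR'S LEMMA 2.1 = DCJ'S LEMMA 4.10, VERBATIM, IN THE FIRST-ORDER KURAMOTO MODEL.** If the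
stability matrix `M(θ) = −L(θ)` is negative semidefinite — the prints' DEFINITION of a stable
(synchronous / fixed-point) solution — then for every node set `S`,
`Σ_{i∈S} Σ_{j∉S} Pᵢⱼ cos(θᵢ − θⱼ) ≥ 0`. «Let {θᵢ⁽⁰⁾} be any stable solution … on any network. Then for
any non-empty node subset S, Σ_{⟨ij⟩: i∈S, j∉S} cos(Δᵢⱼ⁽⁰⁾) ≥ 0.» (For `S = ∅` the sum is `0`; no
symmetry, sign or equilibrium hypothesis enters this implication.)
[cite: TaylorKuramoto2012, §2 Lemma 2.1 (arXiv:1109.4451 p0008 L1–L5); DelabaysColettaJacquod2016, §4.3 Lemma 4.10 (arXiv:1512.04266 p0013 L21–L26)] -/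
theorem cut_nonneg_of_stabilityMatrix_negSemidef {θ : Fin n → ℝ}
    (hst : ∀ z : Fin n → ℝ, z ⬝ᵥ ((-Kur.toDroopNetwork.lap θ) *ᵥ z) ≤ 0) (S : Finset (Fin n)) :
    0 ≤ ∑ i ∈ S, ∑ j ∈ Sᶜ, Kur.P i j * Real.cos (θ i - θ j) := by
  have h := hst (fun i => if i ∈ S then (1 : ℝ) else 0)
  rw [Matrix.neg_mulVec, dotProduct_neg, neg_nonpos, Kur.dotProduct_lap_mulVec,
    Kur.linForm_indicator] at h
  exact h

/-- **… in the eigenvalue wording** (`P` symmetric, so `M` is real symmetric): «all the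
eigenvalues of the matrix M are less than or equal to zero» ⇒ every cut is `≥ 0`.
[cite: TaylorKuramoto2012, §2 (definition after (2.3), p0007 L15) and Lemma 2.1 (p0008 L1–L5)] -/
theorem cut_nonneg_of_eigenvalues_nonpos (hP : ∀ i j, Kur.P i j = Kur.P j i) {θ : Fin n → ℝ}
    (hst : ∀ i, (Kur.isHermitian_neg_lap hP θ).eigenvalues i ≤ 0) (S : Finset (Fin n)) :
    0 ≤ ∑ i ∈ S, ∑ j ∈ Sᶜ, Kur.P i j * Real.cos (θ i - θ j) :=
  Kur.cut_nonneg_of_stabilityMatrix_negSemidef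
    ((negSemidef_iff_eigenvalues_nonpos (Kur.isHermitian_neg_lap hP θ)).2 hst) S

/-- **Contrapositive, as DCJ use it**: «if we can partition the nodes of the network in two sets S
and Sᶜ, such that the sum of cosines of the angle differences on all the lines between these two
sets is smaller than 0, then the solution is unstable» — `M(θ)` is NOT negative semidefinite: the
indicator of `S` is a direction with `zᵀMz > 0`.
[cite: DelabaysColettaJacquod2016, §4.3 (arXiv:1512.04266 p0013 L28–L30)] -/
theorem stabilityMatrix_not_negSemidef_of_negative_cut {θ : Fin n → ℝ} (S : Finset (Fin n))
    (hcut : ∑ i ∈ S, ∑ j ∈ Sᶜ, Kur.P i j * Real.cos (θ i - θ j) < 0) :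
    ∃ z : Fin n → ℝ, 0 < z ⬝ᵥ ((-Kur.toDroopNetwork.lap θ) *ᵥ z) := by
  refine ⟨fun i => if i ∈ S then (1 : ℝ) else 0, ?_⟩
  rw [Matrix.neg_mulVec, dotProduct_neg, neg_pos, Kur.dotProduct_lap_mulVec, Kur.linForm_indicator]
  exact hcut

/-! ### §3. The dynamic notion: a Lyapunov-stable phase-locked solution has every cut `≥ 0` -/

/-- **A negative cut makes the phase-locked solution UNSTABLE** (`Dᵢ > 0`, `φ = 0`, `P` symmetric,
`θ*` phase-locked: `fieldᵢ(θ*) = ω_sync`): there is `ε > 0` such that for every `η > 0` some phase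
vector `x₁` with `‖x₁ − θ*‖ < η` has all motions from `x₁` leave the `ε`-tube around
`t ↦ θ* + ω_sync t𝟙` (lit-2's `lockedSolution_unstable_of_negativeDirection` on Taylor's test
vector `1_S`). [cite: DelabaysColettaJacquod2016, §4.3 (arXiv:1512.04266 p0013 L28–L30); TaylorKuramoto2012, §2 Lemma 2.1; Khalil2002, Theorem 4.7 (part 2)] -/
theorem lockedSolution_unstable_of_negative_cut (hD : ∀ i, 0 < Kur.D i)
    (hφ : ∀ i j, Kur.φ i j = 0) (hP : ∀ i j, Kur.P i j = Kur.P j i) {θu : Fin n → ℝ}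
    (hθu : ∀ i, Kur.field θu i = (∑ j, Kur.ω j) / ∑ j, Kur.D j) (S : Finset (Fin n))
    (hcut : ∑ i ∈ S, ∑ j ∈ Sᶜ, Kur.P i j * Real.cos (θu i - θu j) < 0) :
    ∃ ε > 0, ∀ η > 0, ∃ x₁ : Fin n → ℝ, ‖x₁ - θu‖ < η ∧ ∀ θ : ℝ → Fin n → ℝ,
      (∀ T : ℝ, ∀ t ∈ Icc 0 T, HasDerivWithinAt θ (Kur.field (θ t)) (Icc 0 T) t) → θ 0 = x₁ →
      ∃ t : ℝ, 0 ≤ t ∧ ε < ‖θ t - fun i => θu i + (∑ j, Kur.ω j) / (∑ j, Kur.D j) * t‖ := by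
  refine Kur.lockedSolution_unstable_of_negativeDirection hD hφ hP hθu
    (e := fun i => if i ∈ S then (1 : ℝ) else 0) ?_
  rw [Kur.linForm_indicator]
  exact hcut

/-- ★★ **The print's notion is NECESSARY for Lyapunov stability**: if the phase-locked solution
`t ↦ θ* + ω_sync t𝟙` is Lyapunov stable — for every `ε > 0` some `δ > 0` such that every motion from
every phase vector `x₁` with `‖x₁ − θ*‖ < δ` stays in the `ε`-tube for all `t ≥ 0` (motions exist from
every `x₁`, `exists_globalSolution`) — then `Σᵢ vᵢ Σⱼ Pᵢⱼcos(θ*ᵢ − θ*ⱼ)(vᵢ − vⱼ) ≥ 0` for EVERY `v`,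
i.e. the stability matrix `M(θ*)` is negative semidefinite. («It is unstable if at least one
eigenvalue … is negative», contrapositive.)
[cite: ManikTimmeWitthaut2017, §3 Lemma 1 («for both the Kuramoto system and the power grid model»); DelabaysColettaJacquod2016, §2.2 (arXiv:1512.04266 p0006 L9–L10); Khalil2002, Theorem 4.7 (part 2)] -/
theorem linForm_nonneg_of_lockedSolution_stable (hD : ∀ i, 0 < Kur.D i)
    (hφ : ∀ i j, Kur.φ i j = 0) (hP : ∀ i j, Kur.P i j = Kur.P j i) {θu : Fin n → ℝ}
    (hθu : ∀ i, Kur.field θu i = (∑ j, Kur.ω j) / ∑ j, Kur.D j)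
    (hst : ∀ ε > 0, ∃ δ > 0, ∀ x₁ : Fin n → ℝ, ‖x₁ - θu‖ < δ → ∀ θ : ℝ → Fin n → ℝ,
      θ 0 = x₁ → (∀ T : ℝ, ∀ t ∈ Icc 0 T, HasDerivWithinAt θ (Kur.field (θ t)) (Icc 0 T) t) →
      ∀ t, 0 ≤ t → ‖θ t - fun i => θu i + (∑ j, Kur.ω j) / (∑ j, Kur.D j) * t‖ < ε)
    (v : Fin n → ℝ) :
    0 ≤ ∑ i, v i * ∑ j, Kur.toDroopNetwork.linWeight θu i j * (v i - v j) := by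
  by_contra hneg
  push Not at hneg
  obtain ⟨ε, hε, hall⟩ := Kur.lockedSolution_unstable_of_negativeDirection hD hφ hP hθu hneg
  obtain ⟨δ, hδ, hstay⟩ := hst ε hε
  obtain ⟨x₁, hx₁, hesc⟩ := hall δ hδ
  obtain ⟨θ, hθ0, hθ⟩ := Kur.exists_globalSolution hD x₁
  obtain ⟨t, ht, hfar⟩ := hesc θ hθ hθ0
  have := hstay x₁ hx₁ θ hθ0 hθ t ht
  linarith

/-- **… equivalently `M(θ*) = −L(θ*)` is negative semidefinite** (matrix form of the preceding).
[cite: DelabaysColettaJacquod2016, §2.2 (arXiv:1512.04266 p0006 L9–L10); ManikTimmeWitthaut2017, §3 Lemma 1] -/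
theorem stabilityMatrix_negSemidef_of_lockedSolution_stable (hD : ∀ i, 0 < Kur.D i)
    (hφ : ∀ i j, Kur.φ i j = 0) (hP : ∀ i j, Kur.P i j = Kur.P j i) {θu : Fin n → ℝ}
    (hθu : ∀ i, Kur.field θu i = (∑ j, Kur.ω j) / ∑ j, Kur.D j)
    (hst : ∀ ε > 0, ∃ δ > 0, ∀ x₁ : Fin n → ℝ, ‖x₁ - θu‖ < δ → ∀ θ : ℝ → Fin n → ℝ,
      θ 0 = x₁ → (∀ T : ℝ, ∀ t ∈ Icc 0 T, HasDerivWithinAt θ (Kur.field (θ t)) (Icc 0 T) t) →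
      ∀ t, 0 ≤ t → ‖θ t - fun i => θu i + (∑ j, Kur.ω j) / (∑ j, Kur.D j) * t‖ < ε)
    (z : Fin n → ℝ) :
    z ⬝ᵥ ((-Kur.toDroopNetwork.lap θu) *ᵥ z) ≤ 0 := by
  rw [Matrix.neg_mulVec, dotProduct_neg, neg_nonpos, Kur.dotProduct_lap_mulVec]
  exact Kur.linForm_nonneg_of_lockedSolution_stable hD hφ hP hθu hst z

/-- ★★ **TAYLOR'S LEMMA 2.1 WITH «STABLE» = LYAPUNOV STABLE** (first-order Kuramoto model, `Dᵢ > 0`,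
`φ = 0`, `P` symmetric): at a phase-locked state whose locked solution is Lyapunov stable, every cut
has `Σ_{i∈S} Σ_{j∉S} Pᵢⱼ cos(θ*ᵢ − θ*ⱼ) ≥ 0`.
[cite: TaylorKuramoto2012, §2 Lemma 2.1 (arXiv:1109.4451 p0008 L1–L5); DelabaysColettaJacquod2016, §4.3 Lemma 4.10; Khalil2002, Theorem 4.7 (part 2)] -/
theorem cut_nonneg_of_lockedSolution_stable (hD : ∀ i, 0 < Kur.D i)
    (hφ : ∀ i j, Kur.φ i j = 0) (hP : ∀ i j, Kur.P i j = Kur.P j i) {θu : Fin n → ℝ}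
    (hθu : ∀ i, Kur.field θu i = (∑ j, Kur.ω j) / ∑ j, Kur.D j)
    (hst : ∀ ε > 0, ∃ δ > 0, ∀ x₁ : Fin n → ℝ, ‖x₁ - θu‖ < δ → ∀ θ : ℝ → Fin n → ℝ,
      θ 0 = x₁ → (∀ T : ℝ, ∀ t ∈ Icc 0 T, HasDerivWithinAt θ (Kur.field (θ t)) (Icc 0 T) t) →
      ∀ t, 0 ≤ t → ‖θ t - fun i => θu i + (∑ j, Kur.ω j) / (∑ j, Kur.D j) * t‖ < ε)
    (S : Finset (Fin n)) :
    0 ≤ ∑ i ∈ S, ∑ j ∈ Sᶜ, Kur.P i j * Real.cos (θu i - θu j) :=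
  Kur.cut_nonneg_of_stabilityMatrix_negSemidef
    (Kur.stabilityMatrix_negSemidef_of_lockedSolution_stable hD hφ hP hθu hst) S

/-! ### §4. The cycle: a stable solution has at most one line with `|Δ| > π/2` (DCJ §4.3) -/

section Ring

variable {n : ℕ} (Kur : NonuniformKuramoto (n + 1)) (Kv : Fin (n + 1) → ℝ)

/-- **On a cycle, the arc from `ρk₁` to `k₂` is cut exactly by the lines `k₁` and `k₂`**: for the
indicator `z` of `A = {j : (j − ρk₁) mod N ≤ (k₂ − ρk₁) mod N}`,
`Σᵢ zᵢ Σⱼ wᵢⱼ(zᵢ − zⱼ) = K_{k₁}cos(θ_{k₁} − θ_{ρk₁}) + K_{k₂}cos(θ_{k₂} − θ_{ρk₂})` («removing these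
two lines splits the network in two parts, S and Sᶜ»).
[cite: DelabaysColettaJacquod2016, §4.3 (arXiv:1512.04266 p0013 L30–L36)] -/
theorem ring_linForm_indicator_arc (hn : 2 ≤ n)
    (hP : ∀ i j, Kur.P i j = if j = finRotate (n + 1) i then Kv i
      else if i = finRotate (n + 1) j then Kv j else 0)
    (θ : Fin (n + 1) → ℝ) {k₁ k₂ : Fin (n + 1)} (hk : k₁ ≠ k₂) {A : Finset (Fin (n + 1))}
    (hA : ∀ j, j ∈ A ↔ (j - finRotate (n + 1) k₁).val ≤ (k₂ - finRotate (n + 1) k₁).val) :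
    ∑ i, (if i ∈ A then (1 : ℝ) else 0) * ∑ j, Kur.toDroopNetwork.linWeight θ i j
        * ((if i ∈ A then (1 : ℝ) else 0) - (if j ∈ A then (1 : ℝ) else 0))
      = Kv k₁ * Real.cos (θ k₁ - θ (finRotate (n + 1) k₁))
        + Kv k₂ * Real.cos (θ k₂ - θ (finRotate (n + 1) k₂)) := by
  -- the ring read as network-reduced swing data with the same couplings (only `C = P` is used)
  set L : ClassicalModel.LosslessSystem (n + 1) 0 :=
    { M := Kur.D, D := Kur.D, P := Kur.ω, C := Kur.P, K := fun _ b => b.elim0, β := fun b => b.elim0 }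
    with hL
  have hC : ∀ i j, L.C i j = if j = finRotate (n + 1) i then Kv i
      else if i = finRotate (n + 1) j then Kv j else 0 := hP
  have hCs : ∀ i j, L.C i j = L.C j i := ClassicalModel.loadedRing_C_symm L Kv hn hC
  rw [Kur.linForm_indicator θ A]
  have h1 := L.hessForm_indicator_noBus hCs θ A
  have h2 := ClassicalModel.loadedRing_hessForm_indicator_arc L Kv hn hC θ hk hA
  rw [h1] at h2
  exact h2

/-- ★★ **DCJ §4.3 IN THE PRINT'S MODEL AND NOTION: a stable solution of the Kuramoto cycle has AT
MOST ONE line with negative cosine** (`N = n + 1 ≥ 3`, line constants `Kₖ > 0`, any natural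
frequencies; «stable» = `M(θ) = −L(θ)` negative semidefinite): two distinct lines `k₁ ≠ k₂` with
`cos(θ_{k} − θ_{ρk}) < 0` are impossible — the arc between them would be a negative cut. «We
conclude that there is at most a single |Δ_{i,i+1}| > π/2.»
[cite: DelabaysColettaJacquod2016, §4.3 (arXiv:1512.04266 p0013 L21–L38); TaylorKuramoto2012, §2 Lemma 2.1] -/
theorem ring_at_most_one_negative_line_of_stabilityMatrix_negSemidef (hn : 2 ≤ n)
    (hK : ∀ k, 0 < Kv k)
    (hP : ∀ i j, Kur.P i j = if j = finRotate (n + 1) i then Kv i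
      else if i = finRotate (n + 1) j then Kv j else 0)
    {θ : Fin (n + 1) → ℝ} (hst : ∀ z : Fin (n + 1) → ℝ, z ⬝ᵥ ((-Kur.toDroopNetwork.lap θ) *ᵥ z) ≤ 0)
    {k₁ k₂ : Fin (n + 1)} (h₁ : Real.cos (θ k₁ - θ (finRotate (n + 1) k₁)) < 0)
    (h₂ : Real.cos (θ k₂ - θ (finRotate (n + 1) k₂)) < 0) : k₁ = k₂ := by
  by_contra hk
  set A : Finset (Fin (n + 1)) := Finset.univ.filter
    (fun j => (j - finRotate (n + 1) k₁).val ≤ (k₂ - finRotate (n + 1) k₁).val) with hAdef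
  have hA : ∀ j, j ∈ A ↔ (j - finRotate (n + 1) k₁).val ≤ (k₂ - finRotate (n + 1) k₁).val := by
    intro j
    rw [hAdef, Finset.mem_filter]
    simp
  have h := hst (fun i => if i ∈ A then (1 : ℝ) else 0)
  rw [Matrix.neg_mulVec, dotProduct_neg, neg_nonpos, Kur.dotProduct_lap_mulVec,
    Kur.ring_linForm_indicator_arc Kv hn hP θ hk hA] at h
  have := mul_neg_of_pos_of_neg (hK k₁) h₁
  have := mul_neg_of_pos_of_neg (hK k₂) h₂
  linarith

/-- **… so the lines with `cos(θₖ − θ_{ρk}) < 0` (`|Δₖ| > π/2` modulo `2π`) number at most one**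
(print's notion). [cite: DelabaysColettaJacquod2016, §4.3 (arXiv:1512.04266 p0013 L36–L38) and §1 (p0004 L49 «at most one angle difference can exceed π/2»)] -/
theorem ring_card_negative_lines_le_one_of_stabilityMatrix_negSemidef (hn : 2 ≤ n)
    (hK : ∀ k, 0 < Kv k)
    (hP : ∀ i j, Kur.P i j = if j = finRotate (n + 1) i then Kv i
      else if i = finRotate (n + 1) j then Kv j else 0)
    {θ : Fin (n + 1) → ℝ} (hst : ∀ z : Fin (n + 1) → ℝ, z ⬝ᵥ ((-Kur.toDroopNetwork.lap θ) *ᵥ z) ≤ 0) :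
    (Finset.univ.filter
      (fun k : Fin (n + 1) => Real.cos (θ k - θ (finRotate (n + 1) k)) < 0)).card ≤ 1 := by
  rw [Finset.card_le_one]
  intro a ha b hb
  rw [Finset.mem_filter] at ha hb
  exact Kur.ring_at_most_one_negative_line_of_stabilityMatrix_negSemidef Kv hn hK hP hst ha.2 hb.2

/-- ★★ **DCJ §4.3 WITH «STABLE» = LYAPUNOV STABLE** (`N ≥ 3`, `Kₖ > 0`, `Dᵢ > 0`, `φ = 0`, any
natural frequencies; `θ*` phase-locked): if the locked solution `t ↦ θ* + ω_sync t𝟙` is Lyapunov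
stable then two distinct lines with negative cosine are impossible.
[cite: DelabaysColettaJacquod2016, §4.3 (arXiv:1512.04266 p0013 L21–L38); TaylorKuramoto2012, §2 Lemma 2.1; Khalil2002, Theorem 4.7 (part 2)] -/
theorem ring_at_most_one_negative_line_of_lockedSolution_stable (hn : 2 ≤ n) (hK : ∀ k, 0 < Kv k)
    (hP : ∀ i j, Kur.P i j = if j = finRotate (n + 1) i then Kv i
      else if i = finRotate (n + 1) j then Kv j else 0)
    (hD : ∀ i, 0 < Kur.D i) (hφ : ∀ i j, Kur.φ i j = 0) {θu : Fin (n + 1) → ℝ}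
    (hθu : ∀ i, Kur.field θu i = (∑ j, Kur.ω j) / ∑ j, Kur.D j)
    (hst : ∀ ε > 0, ∃ δ > 0, ∀ x₁ : Fin (n + 1) → ℝ, ‖x₁ - θu‖ < δ → ∀ θ : ℝ → Fin (n + 1) → ℝ,
      θ 0 = x₁ → (∀ T : ℝ, ∀ t ∈ Icc 0 T, HasDerivWithinAt θ (Kur.field (θ t)) (Icc 0 T) t) →
      ∀ t, 0 ≤ t → ‖θ t - fun i => θu i + (∑ j, Kur.ω j) / (∑ j, Kur.D j) * t‖ < ε)
    {k₁ k₂ : Fin (n + 1)} (h₁ : Real.cos (θu k₁ - θu (finRotate (n + 1) k₁)) < 0)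
    (h₂ : Real.cos (θu k₂ - θu (finRotate (n + 1) k₂)) < 0) : k₁ = k₂ := by
  set L : ClassicalModel.LosslessSystem (n + 1) 0 :=
    { M := Kur.D, D := Kur.D, P := Kur.ω, C := Kur.P, K := fun _ b => b.elim0, β := fun b => b.elim0 }
    with hL
  have hC : ∀ i j, L.C i j = if j = finRotate (n + 1) i then Kv i
      else if i = finRotate (n + 1) j then Kv j else 0 := hP
  have hPs : ∀ i j, Kur.P i j = Kur.P j i := ClassicalModel.loadedRing_C_symm L Kv hn hC
  exact Kur.ring_at_most_one_negative_line_of_stabilityMatrix_negSemidef Kv hn hK hP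
    (Kur.stabilityMatrix_negSemidef_of_lockedSolution_stable hD hφ hPs hθu hst) h₁ h₂

/-- ★★ **… so a Lyapunov-stable locked solution of the Kuramoto cycle has AT MOST ONE line with
`|Δₖ| > π/2`** (negative cosine). [cite: DelabaysColettaJacquod2016, §4.3 (arXiv:1512.04266 p0013 L36–L38) and §1 (p0004 L49); Khalil2002, Theorem 4.7 (part 2)] -/
theorem ring_card_negative_lines_le_one_of_lockedSolution_stable (hn : 2 ≤ n) (hK : ∀ k, 0 < Kv k)
    (hP : ∀ i j, Kur.P i j = if j = finRotate (n + 1) i then Kv i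
      else if i = finRotate (n + 1) j then Kv j else 0)
    (hD : ∀ i, 0 < Kur.D i) (hφ : ∀ i j, Kur.φ i j = 0) {θu : Fin (n + 1) → ℝ}
    (hθu : ∀ i, Kur.field θu i = (∑ j, Kur.ω j) / ∑ j, Kur.D j)
    (hst : ∀ ε > 0, ∃ δ > 0, ∀ x₁ : Fin (n + 1) → ℝ, ‖x₁ - θu‖ < δ → ∀ θ : ℝ → Fin (n + 1) → ℝ,
      θ 0 = x₁ → (∀ T : ℝ, ∀ t ∈ Icc 0 T, HasDerivWithinAt θ (Kur.field (θ t)) (Icc 0 T) t) →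
      ∀ t, 0 ≤ t → ‖θ t - fun i => θu i + (∑ j, Kur.ω j) / (∑ j, Kur.D j) * t‖ < ε) :
    (Finset.univ.filter
      (fun k : Fin (n + 1) => Real.cos (θu k - θu (finRotate (n + 1) k)) < 0)).card ≤ 1 := by
  rw [Finset.card_le_one]
  intro a ha b hb
  rw [Finset.mem_filter] at ha hb
  exact Kur.ring_at_most_one_negative_line_of_lockedSolution_stable Kv hn hK hP hD hφ hθu hst
    ha.2 hb.2

end Ring

/-! ### §5. Do–Boccaletti–Gross's spanning-tree criterion, cut form (append 2026-08-28): a stable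
phase-locked state has a spanning connected subnetwork of lines with `|Δ| ≤ π/2` -/

/-- **A cut all of whose coupled lines have negative cosine is negative** (`Pᵢⱼ ≥ 0` off the
diagonal, connected coupling graph, `S` a proper non-empty node set): «in a network without a
positive spanning tree it must be possible to partition the nodes into two nonempty sets I₁, I₂ such
that J_{ij} ≤ 0 ∀ i ∈ I₁, j ∈ I₂» — and then Taylor's cut is `< 0`.
[cite: DoBoccalettiGross2012, proof of the spanning-tree criterion (arXiv:1012.0722 p0003 L65–L66); DelabaysColettaJacquod2016, §4.3 Remark (arXiv:1512.04266 p0013 L40–L59)] -/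
theorem cut_neg_of_forall_cos_neg (hP0 : ∀ i j, i ≠ j → 0 ≤ Kur.P i j)
    (hconn : ClassicalModel.CouplingConnected Kur.P) {θ : Fin n → ℝ} {S : Finset (Fin n)}
    (hS : S.Nonempty) (hSc : Sᶜ.Nonempty)
    (hneg : ∀ i ∈ S, ∀ j ∈ Sᶜ, 0 < Kur.P i j → Real.cos (θ i - θ j) < 0) :
    ∑ i ∈ S, ∑ j ∈ Sᶜ, Kur.P i j * Real.cos (θ i - θ j) < 0 := by
  have hterm : ∀ i ∈ S, ∀ j ∈ Sᶜ, Kur.P i j * Real.cos (θ i - θ j) ≤ 0 := by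
    intro i hi j hj
    have hij : i ≠ j := fun h => (Finset.mem_compl.1 hj) (h ▸ hi)
    rcases (hP0 i j hij).eq_or_lt with h0 | hpos
    · rw [← h0, zero_mul]
    · exact (mul_neg_of_pos_of_neg hpos (hneg i hi j hj hpos)).le
  obtain ⟨i₀, hi₀, j₀, hj₀, hP⟩ := hconn S hS hSc
  have hrow : ∀ i ∈ S, ∑ j ∈ Sᶜ, Kur.P i j * Real.cos (θ i - θ j) ≤ 0 :=
    fun i hi => Finset.sum_nonpos fun j hj => hterm i hi j hj
  have hrow₀ : ∑ j ∈ Sᶜ, Kur.P i₀ j * Real.cos (θ i₀ - θ j) < 0 := by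
    calc ∑ j ∈ Sᶜ, Kur.P i₀ j * Real.cos (θ i₀ - θ j) < ∑ j ∈ Sᶜ, (0 : ℝ) :=
          Finset.sum_lt_sum (fun j hj => hterm i₀ hi₀ j hj)
            ⟨j₀, hj₀, mul_neg_of_pos_of_neg hP (hneg i₀ hi₀ j₀ hj₀ hP)⟩
      _ = 0 := Finset.sum_const_zero
  calc ∑ i ∈ S, ∑ j ∈ Sᶜ, Kur.P i j * Real.cos (θ i - θ j) < ∑ i ∈ S, (0 : ℝ) :=
        Finset.sum_lt_sum hrow ⟨i₀, hi₀, hrow₀⟩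
    _ = 0 := Finset.sum_const_zero

/-- ★★ **THE SPANNING-TREE CRITERION, DCJ's form, print's notion**: on a connected network with
non-negative weights, if the stability matrix `M(θ) = −L(θ)` is negative semidefinite then the
lines with `cos(θᵢ − θⱼ) ≥ 0` CONNECT ALL NODES — every cut of the node set is crossed by a coupled
line with non-negative cosine (cut form of «there exists a spanning tree T of the network such that
for all edges e ∈ E_T, cos(Δ_e⁽⁰⁾) ≥ 0»; as DCJ remark, it follows from Taylor's lemma: a cut crossed
only by negative-cosine lines would be negative, `cut_neg_of_forall_cos_neg`).
[cite: DoBoccalettiGross2012, spanning-tree criterion (arXiv:1012.0722 p0003 L63–L66, p0004 L20, L34–L35); DelabaysColettaJacquod2016, §4.3 Remark (arXiv:1512.04266 p0013 L40–L47); TaylorKuramoto2012, §2 Lemma 2.1] -/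
theorem couplingConnected_nonnegCos_of_stabilityMatrix_negSemidef (hP0 : ∀ i j, i ≠ j → 0 ≤ Kur.P i j)
    (hconn : ClassicalModel.CouplingConnected Kur.P) {θ : Fin n → ℝ}
    (hst : ∀ z : Fin n → ℝ, z ⬝ᵥ ((-Kur.toDroopNetwork.lap θ) *ᵥ z) ≤ 0) :
    ClassicalModel.CouplingConnected
      (fun i j => if 0 ≤ Real.cos (θ i - θ j) then Kur.P i j else 0) := by
  intro S hS hSc
  by_contra h
  push Not at h
  have hneg : ∀ i ∈ S, ∀ j ∈ Sᶜ, 0 < Kur.P i j → Real.cos (θ i - θ j) < 0 := by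
    intro i hi j hj hpos
    by_contra hc
    push Not at hc
    have h1 := h i hi j hj
    rw [if_pos hc] at h1
    exact absurd h1 (not_le.2 hpos)
  have hcut := Kur.cut_neg_of_forall_cos_neg hP0 hconn hS hSc hneg
  have := Kur.cut_nonneg_of_stabilityMatrix_negSemidef hst S
  linarith

/-- ★★ **THE SPANNING-TREE CRITERION, Do–Boccaletti–Gross's form**: if the stability matrix
`M(θ) = −L(θ)` is negative definite off the rotational mode (`zᵀMz < 0` for every non-constant `z`
— the print's «locally stable» for the symmetric zero-row-sum Jacobian) and the weights are
non-negative, then the lines with `cos(θᵢ − θⱼ) > 0` — «|x_j − x_i| < π/2» modulo `2π` — CONNECT ALL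
NODES (cut form of «in any phase locked state a spanning tree must exist on which the phase
difference between any two coupled oscillators obeys |x_j − x_i| < π/2»; no connectivity hypothesis:
the indicator of a proper node set is non-constant, so its cut is positive).
[cite: DoBoccalettiGross2012, spanning-tree criterion and its Kuramoto application (arXiv:1012.0722 p0002 L49, p0003 L63–L66, p0004 L20, L34–L35)] -/
theorem couplingConnected_posCos_of_stabilityMatrix_negDef (hP0 : ∀ i j, i ≠ j → 0 ≤ Kur.P i j)
    {θ : Fin n → ℝ}
    (hst : ∀ z : Fin n → ℝ, (¬ ∃ a : ℝ, z = fun _ => a) →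
      z ⬝ᵥ ((-Kur.toDroopNetwork.lap θ) *ᵥ z) < 0) :
    ClassicalModel.CouplingConnected
      (fun i j => if 0 < Real.cos (θ i - θ j) then Kur.P i j else 0) := by
  intro S hS hSc
  obtain ⟨i₁, hi₁⟩ := hS
  obtain ⟨j₁, hj₁⟩ := hSc
  -- the indicator of `S` is not constant, so its cut is positive
  have hnc : ¬ ∃ a : ℝ, (fun i => if i ∈ S then (1 : ℝ) else 0) = fun _ => a := by
    rintro ⟨a, ha⟩
    have h1 := congrFun ha i₁
    have h2 := congrFun ha j₁
    simp only [if_pos hi₁, if_neg (Finset.mem_compl.1 hj₁)] at h1 h2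
    linarith
  have hcut : 0 < ∑ i ∈ S, ∑ j ∈ Sᶜ, Kur.P i j * Real.cos (θ i - θ j) := by
    have h := hst _ hnc
    rw [Matrix.neg_mulVec, dotProduct_neg, neg_lt_zero, Kur.dotProduct_lap_mulVec,
      Kur.linForm_indicator] at h
    exact h
  by_contra h
  push Not at h
  have hterm : ∀ i ∈ S, ∀ j ∈ Sᶜ, Kur.P i j * Real.cos (θ i - θ j) ≤ 0 := by
    intro i hi j hj
    have hij : i ≠ j := fun e => (Finset.mem_compl.1 hj) (e ▸ hi)
    have h1 := h i hi j hj
    by_cases hc : 0 < Real.cos (θ i - θ j)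
    · rw [if_pos hc] at h1
      have hP : Kur.P i j = 0 := le_antisymm h1 (hP0 i j hij)
      rw [hP, zero_mul]
    · exact mul_nonpos_of_nonneg_of_nonpos (hP0 i j hij) (not_lt.1 hc)
  have hle : ∑ i ∈ S, ∑ j ∈ Sᶜ, Kur.P i j * Real.cos (θ i - θ j) ≤ 0 :=
    Finset.sum_nonpos fun i hi => Finset.sum_nonpos fun j hj => hterm i hi j hj
  linarith

/-- ★★ **THE SPANNING-TREE CRITERION WITH «STABLE» = LYAPUNOV STABLE** (first-order model, `Dᵢ > 0`,
`φ = 0`, `P` symmetric with non-negative weights, connected coupling graph): at a phase-locked state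
whose locked solution `t ↦ θ* + ω_sync t𝟙` is Lyapunov stable, the lines with `cos(θ*ᵢ − θ*ⱼ) ≥ 0`
connect all nodes. [cite: DoBoccalettiGross2012, spanning-tree criterion (arXiv:1012.0722 p0004 L20, L34–L35); DelabaysColettaJacquod2016, §4.3 Remark; Khalil2002, Theorem 4.7 (part 2)] -/
theorem couplingConnected_nonnegCos_of_lockedSolution_stable (hD : ∀ i, 0 < Kur.D i)
    (hφ : ∀ i j, Kur.φ i j = 0) (hP : ∀ i j, Kur.P i j = Kur.P j i)
    (hP0 : ∀ i j, i ≠ j → 0 ≤ Kur.P i j) (hconn : ClassicalModel.CouplingConnected Kur.P)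
    {θu : Fin n → ℝ} (hθu : ∀ i, Kur.field θu i = (∑ j, Kur.ω j) / ∑ j, Kur.D j)
    (hst : ∀ ε > 0, ∃ δ > 0, ∀ x₁ : Fin n → ℝ, ‖x₁ - θu‖ < δ → ∀ θ : ℝ → Fin n → ℝ,
      θ 0 = x₁ → (∀ T : ℝ, ∀ t ∈ Icc 0 T, HasDerivWithinAt θ (Kur.field (θ t)) (Icc 0 T) t) →
      ∀ t, 0 ≤ t → ‖θ t - fun i => θu i + (∑ j, Kur.ω j) / (∑ j, Kur.D j) * t‖ < ε) :
    ClassicalModel.CouplingConnected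
      (fun i j => if 0 ≤ Real.cos (θu i - θu j) then Kur.P i j else 0) :=
  Kur.couplingConnected_nonnegCos_of_stabilityMatrix_negSemidef hP0 hconn
    (Kur.stabilityMatrix_negSemidef_of_lockedSolution_stable hD hφ hP hθu hst)

end NonuniformKuramoto

end Literature.MathematicalPhysics.PowerSystems

end
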